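import Summits.Ventures.PercRepro.RankLevelSetLevelEightGXTForm
import Summits.Ventures.PercRepro.RankLevelSetCoreEightOfFormGXT
import Summits.Ventures.PercRepro.RankLevelSetCoreEightLargeCorankGXT
import Summits.Ventures.PercRepro.RankLevelSetLevelSevenRowSeventyTwo
import Summits.Ventures.PercRepro.S3SixWindow

/-!
# PercRepro — THEOREM C₈ ON THE GIANT-EXACT COUNT WITH LEMMA T5: C-025 AT LEVEL `8` FOR EVERY FINITE MATROID AND EVERY `p ≥ 112`
(p2, gen 35; a feeder for S4 — the top of the `q = 8` window, from `126`)

The level-`8` GX chain of RankLevelSetLevelEightGX (`c025_eight_large_gx'`: `p ≥ 126`, on p8 g18's giant-exact count) with p8 g18's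
LEMMA T5 of the circuit ladder (`S1.fortyEight_mul_ncard_five_circuits_le` at `a = 7`: `s₅ ≤ 7·d(d+1)(d+2)(d+3)/48` in place of
`C(d + 4, 5)`), which takes the `79`-point-flat cells `(p, 65 … 72)` — the floor of the GX chain — from the `N`-side: every cell
`(p, d)`, `9 ≤ d ≤ 187`, closes at the UNIFORM base `p ≥ 112` (the 179 polynomial certificates of RankLevelSetLevelEightGXTArith{A…Q},
the exact tails of RankLevelSetLevelEightGXTTails{A…E}, the dispatcher `gxt_form_eight`), and the large-corank regime closes from
corank `188` (`largeEight_all_gxt`); the row `111` fails at the cells `(111, 71)` and `(111, 72)`.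
* **`c025_core_eight_bounded_corank_gxt`** — the `e`-free core at level `8`, corank `9 ≤ d ≤ 187`, rank `p ≥ 112`;
* **`c025_eight_of_seven_gxt_from`** — for every `P ≥ 112`: level `7` for all `p ≥ P` implies level `8` for all `p ≥ P + 1`;
* **`c025_eight_at_one_twelve`** — level `8` at rank `112`, every finite matroid (the per-rank wrapper
  `rls_succ_large_at 7 8 112` on level `7` at `111`, p8 g18's `c025_seven_large_seventy_two`);
* **`c025_eight_large_gxt'`** — UNCONDITIONAL over the tree: level `8` for every `p ≥ 112`; **`c025_eight_large_gxt`** the same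
  in the literal `C025` body.
Axioms: standard.
-/

open scoped Matroid

namespace PercRepro

namespace ThmN

open Set

variable {α : Type}

/-- **The `e`-free core at level `8`, corank `9 ≤ d ≤ 187`, rank `p ≥ 112`, on the giant-exact count**: the form of the cell
from `gxt_form_eight` through `c025_core_eight_of_form_gxt`. -/
theorem c025_core_eight_bounded_corank_gxt (M : Matroid α) [M.Finite] (p d : ℕ) (hp : 112 ≤ p) (hd9 : 9 ≤ d)
    (hd187 : d ≤ 187) (hR : M.eRank = (p : ℕ∞)) (hn : M.E.ncard = p + d)
    (hfree : ∀ e ∈ M.E, ∃ A ⊆ M.E \ {e}, e ∉ M.closure A ∧ e ∉ M.closure ((M.E \ {e}) \ A)) :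
    RLS M p 8 :=
  c025_core_eight_of_form_gxt M p d hd9 hR hn hfree (gxt_form_eight d hd9 hd187 p hp (p + d) (by omega))

/-- **THEOREM C₈ ON THE GIANT-EXACT COUNT, GIVEN LEVEL `7` FROM `P`**: for every `P ≥ 112`, level `7` for all `p ≥ P` implies
level `8` for all `p ≥ P + 1` (the core at corank `9 ≤ d ≤ 187` by `c025_core_eight_bounded_corank_gxt`, at corank `≥ 188` by
`c025_core_eight_large_corank_gxt`; the coranks `≤ 8` are `U = ∅` or Theorem M). -/
theorem c025_eight_of_seven_gxt_from (P : ℕ) (hP : 112 ≤ P)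
    (h7 : ∀ (M : Matroid α) [M.Finite] (p : ℕ), P ≤ p → RLS M p 7) :
    ∀ (M : Matroid α) [M.Finite] (p : ℕ), P + 1 ≤ p → RLS M p 8 := by
  intro M _ p hp
  refine rls_succ_large (α := α) 7 8 P ?_ ?_ ?_ M p hp (by omega)
  · intro M' _ p' hP' _
    exact h7 M' p' hP'
  · intro M' _ p' _ hn _
    rcases Nat.lt_or_ge M'.E.ncard (p' + 8) with h | h
    · exact RLS_of_ncard_lt M' h
    · exact RLS_of_ncard_eq M' (by omega)
  · intro M' _ p' hP' hR hbig _ hfree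
    rcases Nat.lt_or_ge M'.E.ncard (p' + 188) with h | h
    · exact c025_core_eight_bounded_corank_gxt M' p' (M'.E.ncard - p') (by omega) (by omega) (by omega) hR
        (by omega) hfree
    · exact c025_core_eight_large_corank_gxt M' p' (by omega) hR (by omega) hfree

/-- **Level `8` at rank `112`, every finite matroid**: `rls_succ_large_at 7 8 112` on level `7` at `111`
(`c025_seven_large_seventy_two`), the coranks `≤ 8` (`U = ∅` or Theorem M) and the core at `112`. -/
theorem c025_eight_at_one_twelve (M : Matroid α) [M.Finite] : RLS M 112 8 := by
  refine rls_succ_large_at (α := α) 7 8 112 (by norm_num)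
    (fun M _ => c025_seven_large_seventy_two M 111 (by norm_num)) ?_ ?_ M
  · -- corank `≤ 8`: `U = ∅` or Theorem M
    intro M _ hn
    rcases Nat.lt_or_ge M.E.ncard (112 + 8) with h | h
    · exact RLS_of_ncard_lt M h
    · exact RLS_of_ncard_eq M (by omega)
  · -- the core at corank `≥ 9`
    intro M _ hR hbig hfree
    rcases Nat.lt_or_ge M.E.ncard (112 + 188) with h | h
    · exact c025_core_eight_bounded_corank_gxt M 112 (M.E.ncard - 112) (le_refl _) (by omega) (by omega) hR
        (by omega) hfree
    · exact c025_core_eight_large_corank_gxt M 112 (le_refl _) hR (by omega) hfree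

/-- **THEOREM C₈ AT `112`, UNCONDITIONAL OVER THE TREE**: every finite matroid satisfies C-025 at level `8` for every
`p ≥ 112` — the row `112` by `c025_eight_at_one_twelve`, the rows `≥ 113` through the wrapper at `P = 112` on level `7`
for `p ≥ 72` (p8 g18's `c025_seven_large_seventy_two`). -/
theorem c025_eight_large_gxt' (M : Matroid α) [M.Finite] (p : ℕ) (hp : 112 ≤ p) : RLS M p 8 := by
  rcases Nat.lt_or_ge p 113 with h | h
  · have h112 : p = 112 := by omega
    subst h112
    exact c025_eight_at_one_twelve M
  · exact c025_eight_of_seven_gxt_from 112 (by norm_num)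
      (fun M' _ p' hp' => c025_seven_large_seventy_two M' p' (by omega)) M p h

/-- The same in the literal `C025` body: `phiK p 8 · #U(p, 8) ≤ #Y(p, 8)` for every finite matroid and every `p ≥ 112`. -/
theorem c025_eight_large_gxt (M : Matroid α) [M.Finite] (p : ℕ) (hp : 112 ≤ p) :
    phiK p 8 * ({A : Set α | A ⊆ M.E ∧ M.eRk A = (p : ℕ∞) ∧ M.eRk (M.E \ A) = (8 : ℕ∞)}.ncard : ℚ) ≤
      ({A : Set α | A ⊆ M.E ∧ (8 : ℕ∞) < M.eRk A ∧ M.eRk A < (p : ℕ∞)}.ncard : ℚ) :=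
  c025_eight_large_gxt' M p hp

end ThmN

end PercRepro
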